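import Summits.BirchSwinnertonDyer.Rank1Residual.X11b.BDPRouteShaAn
import HarnessLib

/-!
# Class X11b, route "BDP + converse-theorem engine + Kolyvagin": the two halves of `BSD(E,p)` separately (cell `b2b-bsdres`, sub-cell `multr1-p2`, gen 3)

HONEST FRAMING (cell `b2b-bsdres`, run/shared/lean/b2b/bsd-rank1-residual/, verbatim in every
file): the goal of the cell is to DELETE the COMBINATION-SHAPED residual classes of the
Birch–Swinnerton-Dyer formula for ALL analytic-rank `≤ 1` elliptic curves over `ℚ` — "full BSD
formula for every rank `≤ 1` curve in class `C`" assembled STRICTLY from published theorems — so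
that the rank-`≤ 1` remainder becomes exactly the CONSTRUCTION-SHAPED classes, which are TYPED
(missing-input `Prop`s), NOT attempted. This is not "finishing BSD". Sub-cell `multr1-p2` is a
RESEARCH ROUTE on class X11b (`ClassX11b W p := r_an = 1 ∧ p ≠ 2 ∧ mult(p) ∧ irr(p)`,
`Partition/Rows.lean`); no claim beyond the stated class and locus; X11b's label does not change.

THEOREMS ONLY (no definition, no named fact). The currency is the cell's
`Literature/…/Rank1Residual/Typed/Basic.lean`: `Typed.MissingLowerBoundAt W p` ("`#Ш(E)_an` is a
rational `q` with `ord_p q ≤ ord_p #Ш(E)`", the main-conjecture / Eisenstein-congruence direction)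
and `Typed.MissingUpperBoundAt W p` ("`ord_p #Ш(E) ≤ ord_p q`", the Euler-system direction); the two
make Miller's `BSD(E,p)` in analytic rank `≤ 1` (`Typed.missingPPartAt_of_lower_of_upper`,
`Typed.bsdp_of_missingPPartAt`). Jetchev–Skinner–Wan, Camb. J. Math. 5 (2017) §7.4 prove the two
halves SEPARATELY (arXiv:1512.06894 pp. 30–31): §7.4.1 "(eq:shalowerK-1) … As
`Ш(E/K′)[p^∞] ≅ Ш(E/ℚ)[p^∞] ⊕ Ш(E^{D′}/ℚ)[p^∞]`, from the above lower bound on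
`ord_p(#Ш(E/K′)[p^∞])` and Theorem 7.2.1 (i) for `𝓔 = E^{D′}` we conclude (eq:shalower)
`ord_p(#Ш(E/ℚ)[p^∞]) ≥ ord_p(L′(E,1)/(Ω_E·Reg(E/ℚ)∏_ℓ c_ℓ(E/ℚ)))`"; §7.4.2 "From Theorem 4.4.1
[Kolyvagin] we obtain `ord_p(#Ш(E/K″)[p^∞]) ≤ 2·ord_p(m_{K″})` … Appealing to part (ii) or (iii) of
Theorem 7.2.1 (for `𝓔 = E^{D″}`) then yields (eq:shaupper)". This file does the same on the common
core `exists_shaAn_padicVal_eq_of_heegner` (`X11b/BDPRouteShaAn.lean`), at a prime `p ∥ N`: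

* `missingLowerBoundAt_of_indexLowerBoundAt` — STEP L of the route (the typed input
  `IndexLowerBoundAt`, OPEN at `p ∥ N`: `X11b/BDPRoute.lean`) + the `≤`-half of the rank-`0`
  `p`-part for the twist ⇒ `MissingLowerBoundAt W p`, with NO condition on `∏_ℓ c_ℓ(E)` (the
  Tamagawa term of STEP L is exactly the Tamagawa term of BSD over `K`; only Kolyvagin's bound is
  blind to it). At `p ∥ N` the twist's `≤`-half is supplied in the assembly by Skinner 2016 Thm. C
  (the tree's `Skinner2016.thmC_padicValRat_bsd_rank_zero`, an equality; Kato's inequality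
  Thm. 7.2.1 (i) of Jetchev–Skinner–Wan is printed for "good or multiplicative reduction at the odd
  prime `p`" but its source, Kato 2004 Thm. 17.4, is stated for good ordinary `p` — Skinner 2016
  p. 2: "this case [`p ∣ N`] is excluded from Kato's divisibility theorem" —, so it is NOT vendored).
* `missingUpperBoundAt_of_shaIndexBound` — an upper bound of Kolyvagin's shape
  `ord_p #Ш(E/K) ≤ 2·ord_p [E(K):ℤP]` (hypothesis `hU`; Kolyvagin 1990 / McCallum 1991 for
  `ρ̄_{E,p}` surjective, tree fact `Kolyvagin1990_padicValNat_card_sha_le`; Matar–Nekovář 2019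
  Thm. 0.3 + Cor. 5.21 for `E[p]` irreducible, `d_K ≠ −3, −4`) + the `≥`-half for the twist +
  `p ∤ ∏_ℓ c_ℓ(E)` ⇒ `MissingUpperBoundAt W p` — NO typed input: on the route's `Locus` the
  Euler-system half of `BSD(E,p)` is a theorem of the published record (assembly:
  `X11b/BDPRouteHalvesClass.lean`).
* `bsdp_of_halves` — bookkeeping: both halves ⇒ `BSDp W p` (recovers `bsdp_of_indexIdentityAt`).

References: [JetchevSkinnerWan2017] §7.2 Thm. 7.2.1, §7.4.1–7.4.2 (pp. 28–31 of arXiv:1512.06894);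
[Skinner2016PacificMC] Thm. C, p. 2; [Kato2004Asterisque] Thm. 17.4 (p. 273); [McCallumLMS1991]
§1; [MatarNekovar2019] Thm. 0.3, §0.11, Cor. 5.21; [Miller2011LMS] Def. 1.1.
-/

noncomputable section

open scoped Classical

open WeierstrassCurve NumberField Literature.NumberTheory.EllipticCurves
  Literature.NumberTheory.EllipticCurves.ModularForms
  Literature.NumberTheory.EllipticCurves.Rank1Residual
  Literature.NumberTheory.EllipticCurves.KrizLi2019

namespace Summit.BirchSwinnertonDyer.Rank1Residual.X11b

/-- **The main-conjecture half of `BSD(E,p)` from STEP L (Jetchev–Skinner–Wan 2017 §7.4.1 at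
`p ∥ N`), with NO Tamagawa condition.** Data as in `exists_shaAn_padicVal_eq_of_heegner` (`W/ℚ`
globally minimal, `ord_{s=1} L(E,s) = 1`; `K` imaginary quadratic with the Heegner hypothesis for the
conductor `N` and `L(E^{d_K},1) ≠ 0`; `P` the Heegner point of a datum with `p ∤ c`; `p` odd,
`p ∤ #𝓞_K^×`; `Wd = Cd • W^{(d_K)}` globally minimal with `ord_p u(Cd) = 0` and
`ord_p ∏c_ℓ(Wd) = ord_p ∏c_ℓ(W)` (`htam`, Jetchev–Skinner–Wan (eq:tamK); a tree theorem for Heegner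
`K` and `p ≥ 5`, `padicValNat_tamagawaProduct_twist_of_heegner`)); PUBLISHED binders `hGZ`, `hKo`,
`hGZK`, `hmod`; the `≤`-HALF of the rank-`0` `p`-part for the twist (`htw`:
`ord_p #Ш(E^D) + ord_p ∏c_ℓ(E^D) − 2·ord_p #E^D(ℚ)_tors ≤ ord_p (L(E^D,1)/Ω_{E^D})`, the shape of
Jetchev–Skinner–Wan Thm. 7.2.1 (i); supplied at `p ∥ N` by Skinner 2016 Thm. C); and STEP L
(`hL : IndexLowerBoundAt W p K P`, the route's typed input, granted finiteness of `Ш(E/K)`).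
CONCLUSION: `Typed.MissingLowerBoundAt W p` — `ord_p #Ш(E)_an ≤ ord_p #Ш(E)`. Arithmetic:
`v(q) = 2v(I) − v(q_d) − v(c_W) − 2v(t_d) ≤ v(Ш_K) + 2v(c_W) − v(q_d) − v(c_W) − 2v(t_d)
= v(Ш_W) + [v(Ш_d) + v(c_d) − 2v(t_d) − v(q_d)] ≤ v(Ш_W)`. CONDITIONAL on STEP L.
[cite: JetchevSkinnerWan2017, §7.4.1 (eq:shalowerK-1)–(eq:shalower), pp. 30–31]
[cite: Miller2011LMS, Def. 1.1] -/
theorem missingLowerBoundAt_of_indexLowerBoundAt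
    (W : WeierstrassCurve ℚ) [W.IsElliptic] [W.IsGloballyMinimal] (p : ℕ) [Fact p.Prime]
    (N : ℕ) [NeZero N] (K : Type) [Field K] [NumberField K]
    (Dt : ModularParametrizationData W N) (H : HeegnerDatum N (NumberField.discr K)) (ι : K →+* ℂ)
    (P : (W.baseChange K).toAffine.Point)
    -- the published inputs (named facts of the tree)
    (hGZ : gross_zagier N W K) (hKo : kolyvagin N W K)
    (hGZK : rank_eq_analyticRank_of_analyticRank_le_one) (hmod : hasEntireLFunction_rat)
    -- the data
    (hK : IsImaginaryQuadratic K) (hHN : SatisfiesHeegnerHypothesis N K)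
    (hP : WeierstrassCurve.Affine.Point.map ι.toRatAlgHom P = heegnerPointComplex Dt H)
    (hp2 : p ≠ 2) (hc : ¬ (p : ℤ) ∣ Dt.c) (hμ : ¬ p ∣ Units.torsionOrder K)
    (hr : W.analyticRank = 1)
    (hLt : (W.quadraticTwist (NumberField.discr K : ℚ)).entireLFunction 1 ≠ 0)
    -- a globally minimal model of the quadratic twist by `d_K`
    (Wd : WeierstrassCurve ℚ) [Wd.IsElliptic] [Wd.IsGloballyMinimal] (Cd : VariableChange ℚ)
    (hWd : Cd • W.quadraticTwist (NumberField.discr K : ℚ) = Wd)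
    (hu : padicValRat p (Cd.u : ℚ) = 0)
    (htam : padicValNat p Wd.tamagawaProduct = padicValNat p W.tamagawaProduct)
    -- the `≤`-half of the rank-zero `p`-part for the twist
    (htw : ∃ q : ℚ, Wd.entireLFunction 1 / (Wd.realPeriodRat : ℂ) = (q : ℂ) ∧
      (padicValNat p Wd.shaOrder : ℤ) + padicValNat p Wd.tamagawaProduct -
        2 * padicValNat p Wd.torsionOrder ≤ padicValRat p q)
    -- STEP L (the typed input of the route)
    (hL : Finite (W.baseChange K).sha → IndexLowerBoundAt W p K P) :
    Typed.MissingLowerBoundAt W p := by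
  obtain ⟨qd, hqd, hvqd⟩ := htw
  obtain ⟨-, hfinK, hsha, q, hq, hval⟩ := exists_shaAn_padicVal_eq_of_heegner W p N K Dt H ι P
    hGZ hKo hGZK hmod hK hHN hP hp2 hc hμ hr hLt Wd Cd hWd hu qd hqd
  have hKL := hL hfinK
  unfold IndexLowerBoundAt at hKL
  refine ⟨q, hq, ?_⟩
  have e1 : (2 * padicValNat p (AddSubgroup.zmultiples P).index : ℤ) ≤
      padicValNat p (W.baseChange K).shaOrder + 2 * padicValNat p W.tamagawaProduct := by
    exact_mod_cast hKL
  have e2 : (padicValNat p (W.baseChange K).shaOrder : ℤ) =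
      padicValNat p W.shaOrder + padicValNat p Wd.shaOrder := by exact_mod_cast hsha
  have e3 : (padicValNat p Wd.tamagawaProduct : ℤ) = padicValNat p W.tamagawaProduct := by
    exact_mod_cast htam
  omega

/-- **The Euler-system half of `BSD(E,p)` from an upper bound of Kolyvagin's shape
(Jetchev–Skinner–Wan 2017 §7.4.2, with the classical modular parametrisation), when
`p ∤ ∏_ℓ c_ℓ(E)`.** Same data and PUBLISHED binders as `missingLowerBoundAt_of_indexLowerBoundAt`;
instead of STEP L the hypotheses are: `hU` — a bound `ord_p #Ш(E/K) ≤ 2·ord_p [E(K):ℤP]` granted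
finiteness of `Ш(E/K)` and that `P` has infinite order (Kolyvagin 1990 Thm. A / McCallum 1991 §1
for `ρ̄_{E,p}` surjective — tree fact `Kolyvagin1990_padicValNat_card_sha_le`; Matar–Nekovář 2019
Thm. 0.3 with Cor. 5.21 and §0.11 for `E[p]` irreducible and `d_K ≠ −3, −4`); `htw` — the
`≥`-HALF of the rank-`0` `p`-part for the twist
(`ord_p (L(E^D,1)/Ω_{E^D}) ≤ ord_p #Ш(E^D) + ord_p ∏c_ℓ(E^D) − 2·ord_p #E^D(ℚ)_tors`, supplied by
Skinner 2016 Thm. C at `p ∥ N`); and `htam0 : p ∤ ∏_ℓ c_ℓ(E)` (Kolyvagin's bound is blind to the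
Tamagawa term of BSD over `K`, `2·ord_p ∏_ℓ c_ℓ(E)` for a field in which every `ℓ ∣ N` splits —
Jetchev 2008 sharpens it only under `p ∤ N`). CONCLUSION: `Typed.MissingUpperBoundAt W p` —
`ord_p #Ш(E) ≤ ord_p #Ш(E)_an`. Arithmetic: `v(Ш_W) + v(Ш_d) = v(Ш_K) ≤ 2v(I)
= v(q) + v(q_d) + v(c_W) + 2v(t_d) ≤ v(q) + v(Ш_d) + v(c_d) + v(c_W) = v(q) + v(Ш_d) + 2v(c_W)`.
NO typed input. [cite: JetchevSkinnerWan2017, §7.4.2 (eq:shaupper), p. 31]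
[cite: McCallumLMS1991, §1 Theorem (Kolyvagin), p. 296] [cite: Miller2011LMS, Def. 1.1] -/
theorem missingUpperBoundAt_of_shaIndexBound
    (W : WeierstrassCurve ℚ) [W.IsElliptic] [W.IsGloballyMinimal] (p : ℕ) [Fact p.Prime]
    (N : ℕ) [NeZero N] (K : Type) [Field K] [NumberField K]
    (Dt : ModularParametrizationData W N) (H : HeegnerDatum N (NumberField.discr K)) (ι : K →+* ℂ)
    (P : (W.baseChange K).toAffine.Point)
    -- the published inputs (named facts of the tree)
    (hGZ : gross_zagier N W K) (hKo : kolyvagin N W K)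
    (hGZK : rank_eq_analyticRank_of_analyticRank_le_one) (hmod : hasEntireLFunction_rat)
    -- the data
    (hK : IsImaginaryQuadratic K) (hHN : SatisfiesHeegnerHypothesis N K)
    (hP : WeierstrassCurve.Affine.Point.map ι.toRatAlgHom P = heegnerPointComplex Dt H)
    (hp2 : p ≠ 2) (hc : ¬ (p : ℤ) ∣ Dt.c) (hμ : ¬ p ∣ Units.torsionOrder K)
    (hr : W.analyticRank = 1)
    (hLt : (W.quadraticTwist (NumberField.discr K : ℚ)).entireLFunction 1 ≠ 0)
    -- a globally minimal model of the quadratic twist by `d_K`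
    (Wd : WeierstrassCurve ℚ) [Wd.IsElliptic] [Wd.IsGloballyMinimal] (Cd : VariableChange ℚ)
    (hWd : Cd • W.quadraticTwist (NumberField.discr K : ℚ) = Wd)
    (hu : padicValRat p (Cd.u : ℚ) = 0)
    (htam : padicValNat p Wd.tamagawaProduct = padicValNat p W.tamagawaProduct)
    (htam0 : ¬ p ∣ W.tamagawaProduct)
    -- the `≥`-half of the rank-zero `p`-part for the twist
    (htw : ∃ q : ℚ, Wd.entireLFunction 1 / (Wd.realPeriodRat : ℂ) = (q : ℂ) ∧
      padicValRat p q ≤ (padicValNat p Wd.shaOrder : ℤ) + padicValNat p Wd.tamagawaProduct -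
        2 * padicValNat p Wd.torsionOrder)
    -- an upper bound of Kolyvagin's shape over `K`
    (hU : Finite (W.baseChange K).sha → ¬ IsOfFinAddOrder P →
      padicValNat p (Nat.card (W.baseChange K).sha) ≤
        2 * padicValNat p (AddSubgroup.zmultiples P).index) :
    Typed.MissingUpperBoundAt W p := by
  obtain ⟨qd, hqd, hvqd⟩ := htw
  obtain ⟨-, hfinK, hsha, q, hq, hval⟩ := exists_shaAn_padicVal_eq_of_heegner W p N K Dt H ι P
    hGZ hKo hGZK hmod hK hHN hP hp2 hc hμ hr hLt Wd Cd hWd hu qd hqd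
  -- the Heegner point has infinite order (`L'(E,1) ≠ 0`, `L(E^D,1) ≠ 0`, Gross–Zagier)
  have hL0 : W.entireLFunction 1 = 0 := entireLFunction_one_eq_zero_of_analyticRank_eq_one hr
  obtain ⟨-, hderiv⟩ := leadingLCoeff_eq_deriv_of_analyticRank_eq_one hr
  have hLK : LDerivEK W K ≠ 0 := by
    rw [lDerivEK_eq_deriv_mul W K hmod hL0]; exact mul_ne_zero hderiv hLt
  have hPinf : ¬ IsOfFinAddOrder P :=
    (lDerivEK_ne_zero_iff_not_isOfFinAddOrder W N K hGZ hK hHN ⟨Dt, H, ι, hP⟩).mp hLK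
  have hKU : padicValNat p (W.baseChange K).shaOrder ≤
      2 * padicValNat p (AddSubgroup.zmultiples P).index := hU hfinK hPinf
  refine ⟨q, hq, ?_⟩
  have h0 : padicValNat p W.tamagawaProduct = 0 := padicValNat.eq_zero_of_not_dvd htam0
  have e1 : (padicValNat p (W.baseChange K).shaOrder : ℤ) ≤
      2 * padicValNat p (AddSubgroup.zmultiples P).index := by exact_mod_cast hKU
  have e2 : (padicValNat p (W.baseChange K).shaOrder : ℤ) =
      padicValNat p W.shaOrder + padicValNat p Wd.shaOrder := by exact_mod_cast hsha
  have e3 : (padicValNat p Wd.tamagawaProduct : ℤ) = padicValNat p W.tamagawaProduct := by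
    exact_mod_cast htam
  have e4 : (padicValNat p W.tamagawaProduct : ℤ) = 0 := by exact_mod_cast h0
  omega

/-- **Both halves make `BSD(E,p)`** (bookkeeping, in analytic rank `≤ 1`: Gross–Zagier–Kolyvagin
`hGZK` for finiteness of `Ш(E)` and `rank = r_an`; the cell's `Typed.missingPPartAt_of_lower_of_upper`
and `Typed.bsdp_of_missingPPartAt`). [cite: Miller2011LMS, §1 and Def. 1.1] -/
theorem bsdp_of_halves (hGZK : rank_eq_analyticRank_of_analyticRank_le_one)
    (W : WeierstrassCurve ℚ) [W.IsElliptic] (p : ℕ) [Fact p.Prime] (hr : W.analyticRank ≤ 1)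
    (hl : Typed.MissingLowerBoundAt W p) (hu : Typed.MissingUpperBoundAt W p) : BSDp W p :=
  Typed.bsdp_of_missingPPartAt W p hGZK hr (Typed.missingPPartAt_of_lower_of_upper W p hl hu)

end Summit.BirchSwinnertonDyer.Rank1Residual.X11b

end
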